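import Summits.MatrixMultiplication.MatrixMultiplication.Theorems.SaturationLadderFrameShadows
import Literature.Computability.AlgebraicComplexity.MatrixMultiplicationExponent
import HarnessLib

/-!
# `⟨2,2,2⟩` is a restriction of the shadow square `N_{2,3} ⊠ N_{2,3}`
# (route `SaturationLadder`, item stmt-MatrixMultiplication-25909 `SubexpSaturation`; cell `decomp-mm`, lens 1, gen 34)

PROVED, 0 sorry; no definitions, no instances, no notation, no named facts; route-free (imports the
gen-33 kernel `SaturationLadderFrameShadows` for `shadowTensor`, `Literature` and Mathlib only).

The tight shadow `N_{2,3}` (`shadowTensor K 2 3`, entry `[k + y = z]`; the bilinear map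
`K[t]_{≤1} × K[t]_{≤2} → K[t]/(t³)`, border rank `3`, rank `4`) is the common degeneration of all
moment-curve frames `P_{2,3}(λ)` (gen 33, `frameTensor_degeneratesTo_shadowTensor`).  Its Kronecker
square is the bilinear map `K[s,t]_{≤(1,1)} × K[s,t]_{≤(2,2)} → K[s,t]/(s³,t³)` (format `9 × 4 × 9`).

**Theorem** (`shadowTensor_sq_restrictsTo_matMulTensor_222`).  Over every field of characteristic `0`
containing a square root `r` of `5`, the matrix multiplication tensor `⟨2,2,2⟩` is a RESTRICTION of
`N_{2,3} ⊠ N_{2,3}`: there are explicit matrices `A₀` (`4 × 9`, 8 non-zero entries), `B₀` (`4 × 4`,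
8 non-zero entries), `C₀` (`4 × 9`, 9 non-zero entries) with entries in `ℚ(√5) = ℚ(φ)` (every entry is a
rational multiple of a power of the golden ratio) such that `⟨2,2,2⟩ = (A₀ ⊗ B₀ ⊗ C₀) · (N_{2,3} ⊠ N_{2,3})`.
Equivalently: `2 × 2` matrix products `XY` are obtained from ONE product `p · q` in the commutative
algebra `K[s,t]/(s³,t³)` of a `(1,1)`-form `p = β(X)` with a `(2,2)`-form `q = γ(Y)`, followed by a
linear projection — a commutative-algebra realisation of `⟨2,2,2⟩` in dimension `9`.

Consequences for the lineage (memo g34 §4, U1-cash (ii)).  Since every frame degenerates to the shadow,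
`P_{2,3}(λ)^{⊠2} ⊵ N_{2,3}^{⊠2} ≥ ⟨2,2,2⟩`: the level-two matrix-multiplication block of the frame square
(gen 34, `frameTensor_sq_restrictsTo_matMulTensor_222`, a restriction with a RATIONAL certificate) is
already carried by the shadow, up to restriction-versus-degeneration and the field of definition.  This
CORRECTS the numerical remark in the module docstring of `SaturationLadderFrameLift` ("`⟨2,2,2⟩` is not
a restriction of the shadow square numerically"): plain alternating least squares stalls in a swamp
there; a Levenberg–Marquardt search with a vanishing Tikhonov term, `60`-digit Newton polishing and
integer-relation detection finds the solution variety and this algebraic point on it (the greedy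
sparsification that makes `60` of the `88` unknowns vanish lands in `ℚ(√5)`; whether a `ℚ`-rational
point exists is left open).  So the census acceptance test «a format restricted from `P^{⊠N}` but not
from `N^{⊠N}`» FAILS at `N = 2` over `ℚ(√5)` (hence over `ℝ`, `ℂ`): nothing frame-specific survives at
Kronecker levels `N ≤ 2` beyond the value-trivial node collision of level one.

Method of proof: the `324`-term restriction sum against `N ⊠ N` collapses to the `25` support triples
`(k + y, k, y)` (`sum_restrict_shadowTensor_sq`, proved once by `simp`); the `64` target entries are then
identities between cubic polynomials in `r` with rational coefficients, closed by `simp`/`ring_nf` modulo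
`r² = 5`.  Certificate found and verified exactly in `ℚ(√5)` outside Lean first (memo g34 §4, files
`lm_degen.py`, `exactify.py`, `hp_polish.py`, `qsqrt5_verify.py`, `lean_cert_shadow.py`).

References: [BurgisserClausenShokrollahi1997] ((14.19), (15.20): `K[T]/(T^m)` and its truncations; Ex. 15.9),
[Blaser2013] (§4 restriction, §5 the tensor `⟨k,m,n⟩`), [ChristandlVranaZuiddam2023] (§1.1 Kronecker products).
-/

set_option linter.dupNamespace false

noncomputable section

open scoped BigOperators

namespace Summit.MatrixMultiplication.MatrixMultiplication.Theorems.SaturationLadderShadowLift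

open Literature.Computability.AlgebraicComplexity
open Summit.MatrixMultiplication.MatrixMultiplication.Theorems.SaturationLadderFrameShadows

universe u

variable {K : Type u} [Field K]

set_option maxHeartbeats 1600000 in
/-- Collapsing the restriction sum against the shadow square `N_{2,3} ⊠ N_{2,3}`: of the `9 · 4 · 9 = 324`
index triples only the `25` support triples `((k₁+y₁, k₂+y₂), (k₁,k₂), (y₁,y₂))` with `kᵢ + yᵢ ≤ 2`
survive, each with coefficient `1`. [cite: BurgisserClausenShokrollahi1997, (15.20)] -/
theorem sum_restrict_shadowTensor_sq {α β γ : Type*}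
    (A : α → Fin 3 × Fin 3 → K) (B : β → Fin 2 × Fin 2 → K) (Cm : γ → Fin 3 × Fin 3 → K)
    (a' : α) (b' : β) (c' : γ) :
    (∑ x : Fin 3 × Fin 3, ∑ b : Fin 2 × Fin 2, ∑ c : Fin 3 × Fin 3, A a' x * B b' b * Cm c' c *
      kroneckerTensor (shadowTensor K 2 3) (shadowTensor K 2 3) x b c) =
      A a' ((0 : Fin 3), (0 : Fin 3)) * B b' ((0 : Fin 2), (0 : Fin 2)) * Cm c' ((0 : Fin 3), (0 : Fin 3)) +
      A a' ((0 : Fin 3), (1 : Fin 3)) * B b' ((0 : Fin 2), (0 : Fin 2)) * Cm c' ((0 : Fin 3), (1 : Fin 3)) +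
      A a' ((0 : Fin 3), (2 : Fin 3)) * B b' ((0 : Fin 2), (0 : Fin 2)) * Cm c' ((0 : Fin 3), (2 : Fin 3)) +
      A a' ((1 : Fin 3), (0 : Fin 3)) * B b' ((0 : Fin 2), (0 : Fin 2)) * Cm c' ((1 : Fin 3), (0 : Fin 3)) +
      A a' ((1 : Fin 3), (1 : Fin 3)) * B b' ((0 : Fin 2), (0 : Fin 2)) * Cm c' ((1 : Fin 3), (1 : Fin 3)) +
      A a' ((1 : Fin 3), (2 : Fin 3)) * B b' ((0 : Fin 2), (0 : Fin 2)) * Cm c' ((1 : Fin 3), (2 : Fin 3)) +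
      A a' ((2 : Fin 3), (0 : Fin 3)) * B b' ((0 : Fin 2), (0 : Fin 2)) * Cm c' ((2 : Fin 3), (0 : Fin 3)) +
      A a' ((2 : Fin 3), (1 : Fin 3)) * B b' ((0 : Fin 2), (0 : Fin 2)) * Cm c' ((2 : Fin 3), (1 : Fin 3)) +
      A a' ((2 : Fin 3), (2 : Fin 3)) * B b' ((0 : Fin 2), (0 : Fin 2)) * Cm c' ((2 : Fin 3), (2 : Fin 3)) +
      A a' ((0 : Fin 3), (1 : Fin 3)) * B b' ((0 : Fin 2), (1 : Fin 2)) * Cm c' ((0 : Fin 3), (0 : Fin 3)) +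
      A a' ((0 : Fin 3), (2 : Fin 3)) * B b' ((0 : Fin 2), (1 : Fin 2)) * Cm c' ((0 : Fin 3), (1 : Fin 3)) +
      A a' ((1 : Fin 3), (1 : Fin 3)) * B b' ((0 : Fin 2), (1 : Fin 2)) * Cm c' ((1 : Fin 3), (0 : Fin 3)) +
      A a' ((1 : Fin 3), (2 : Fin 3)) * B b' ((0 : Fin 2), (1 : Fin 2)) * Cm c' ((1 : Fin 3), (1 : Fin 3)) +
      A a' ((2 : Fin 3), (1 : Fin 3)) * B b' ((0 : Fin 2), (1 : Fin 2)) * Cm c' ((2 : Fin 3), (0 : Fin 3)) +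
      A a' ((2 : Fin 3), (2 : Fin 3)) * B b' ((0 : Fin 2), (1 : Fin 2)) * Cm c' ((2 : Fin 3), (1 : Fin 3)) +
      A a' ((1 : Fin 3), (0 : Fin 3)) * B b' ((1 : Fin 2), (0 : Fin 2)) * Cm c' ((0 : Fin 3), (0 : Fin 3)) +
      A a' ((1 : Fin 3), (1 : Fin 3)) * B b' ((1 : Fin 2), (0 : Fin 2)) * Cm c' ((0 : Fin 3), (1 : Fin 3)) +
      A a' ((1 : Fin 3), (2 : Fin 3)) * B b' ((1 : Fin 2), (0 : Fin 2)) * Cm c' ((0 : Fin 3), (2 : Fin 3)) +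
      A a' ((2 : Fin 3), (0 : Fin 3)) * B b' ((1 : Fin 2), (0 : Fin 2)) * Cm c' ((1 : Fin 3), (0 : Fin 3)) +
      A a' ((2 : Fin 3), (1 : Fin 3)) * B b' ((1 : Fin 2), (0 : Fin 2)) * Cm c' ((1 : Fin 3), (1 : Fin 3)) +
      A a' ((2 : Fin 3), (2 : Fin 3)) * B b' ((1 : Fin 2), (0 : Fin 2)) * Cm c' ((1 : Fin 3), (2 : Fin 3)) +
      A a' ((1 : Fin 3), (1 : Fin 3)) * B b' ((1 : Fin 2), (1 : Fin 2)) * Cm c' ((0 : Fin 3), (0 : Fin 3)) +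
      A a' ((1 : Fin 3), (2 : Fin 3)) * B b' ((1 : Fin 2), (1 : Fin 2)) * Cm c' ((0 : Fin 3), (1 : Fin 3)) +
      A a' ((2 : Fin 3), (1 : Fin 3)) * B b' ((1 : Fin 2), (1 : Fin 2)) * Cm c' ((1 : Fin 3), (0 : Fin 3)) +
      A a' ((2 : Fin 3), (2 : Fin 3)) * B b' ((1 : Fin 2), (1 : Fin 2)) * Cm c' ((1 : Fin 3), (1 : Fin 3)) := by
  simp [Fintype.sum_prod_type, Fin.sum_univ_succ, kroneckerTensor_apply, shadowTensor_apply]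
  ring

set_option maxHeartbeats 4000000 in
/-- **`⟨2,2,2⟩ ≤ N_{2,3} ⊠ N_{2,3}` over `ℚ(√5)`.**  With `t = N ⊠ N` on
`(Fin 3 × Fin 3) × (Fin 2 × Fin 2) × (Fin 3 × Fin 3)` (`N = shadowTensor K 2 3`, entry `[k+y=z]`) and
`s = ⟨2,2,2⟩` in the tree's convention (`s (κ,ν) (κ',μ) (μ',ν') = [κ=κ' ∧ μ=μ' ∧ ν=ν']`, [Blaser2013] §5),
the matrices `A₀ = aT`, `B₀ = bT`, `C₀ = cT` below (entries `a + b·r`, `a, b ∈ ℚ` with denominators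
dividing `72`, `r² = 5`) satisfy `s = (A₀ ⊗ B₀ ⊗ C₀)·t`; verified entrywise (`64` entries, `25` terms
each) modulo `r² = 5`.  Stated under `CharZero` with the square root as a hypothesis, so that it applies
verbatim to `ℝ` and `ℂ` (`r = √5`). [cite: Blaser2013, §5 (the tensor ⟨k,m,n⟩)] -/
theorem shadowTensor_sq_restrictsTo_matMulTensor_222 [CharZero K] (r : K) (hr : r ^ 2 = 5) :
    TensorRestrictsTo
      (kroneckerTensor (shadowTensor K 2 3) (shadowTensor K 2 3))
      (matMulTensor K 2 2 2) := by
  classical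
  let aT : Fin 2 → Fin 2 → Fin 3 → Fin 3 → K := ![![![![(0 : K), (((-4 : K) / 9) + ((-4 : K) / 9) * r), (0 : K)], ![((-2 : K) / 3), (0 : K), (0 : K)], ![(0 : K), (0 : K), (0 : K)]], ![![(0 : K), (0 : K), (0 : K)], ![(0 : K), (0 : K), ((1 : K) + (-1 : K) * r)], ![(0 : K), ((-3 : K) / 2), (0 : K)]]], ![![![(0 : K), (0 : K), (((-2 : K) / 3) + ((-2 : K) / 9) * r)], ![(0 : K), (((-1 : K) / 2) + ((-1 : K) / 6) * r), (0 : K)], ![(((-1 : K) / 2) + ((-1 : K) / 4) * r), (0 : K), (0 : K)]], ![![(0 : K), (0 : K), (0 : K)], ![(0 : K), (0 : K), (0 : K)], ![(0 : K), (0 : K), ((-3 : K) / 4)]]]]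
  let bT : Fin 2 → Fin 2 → Fin 2 → Fin 2 → K := ![![![![((3 : K) / 4), (0 : K)], ![(0 : K), (0 : K)]], ![![((1 : K) / 3), (0 : K)], ![((-2 : K) / 3), (0 : K)]]], ![![![(0 : K), ((3 : K) / 2)], ![((-1 : K) + (-1 : K) * r), (0 : K)]], ![![(0 : K), ((2 : K) / 3)], ![(((-4 : K) / 9) + ((-4 : K) / 9) * r), ((-2 : K) + ((2 : K) / 3) * r)]]]]
  let cT : Fin 2 → Fin 2 → Fin 3 → Fin 3 → K := ![![![![(-1 : K), ((-3 : K) / 2), (0 : K)], ![((-1 : K) + (1 : K) * r), (0 : K), (0 : K)], ![(0 : K), (0 : K), (0 : K)]], ![![(0 : K), (0 : K), (((1 : K) / 2) + ((1 : K) / 6) * r)], ![(0 : K), (((-2 : K) / 3) + ((-2 : K) / 9) * r), (0 : K)], ![(0 : K), ((-8 : K) / 9), (0 : K)]]], ![![![((9 : K) / 4), (0 : K), (0 : K)], ![(0 : K), (0 : K), (0 : K)], ![(0 : K), (0 : K), (0 : K)]], ![![(0 : K), (0 : K), (((-9 : K) / 8) + ((-3 : K) / 8) * r)], ![(0 : K),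 (((3 : K) / 2) + ((1 : K) / 2) * r), (0 : K)], ![(0 : K), (0 : K), (0 : K)]]]]
  have hr3 : r ^ 3 = 5 * r := by rw [pow_succ, hr]
  let A₀ : Fin 2 × Fin 2 → Fin 3 × Fin 3 → K := fun p x => aT p.1 p.2 x.1 x.2
  let B₀ : Fin 2 × Fin 2 → Fin 2 × Fin 2 → K := fun p b => bT p.1 p.2 b.1 b.2
  let C₀ : Fin 2 × Fin 2 → Fin 3 × Fin 3 → K := fun p x => cT p.1 p.2 x.1 x.2
  refine ⟨A₀, B₀, C₀, fun a' b' c' => ?_⟩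
  rw [sum_restrict_shadowTensor_sq A₀ B₀ C₀ a' b' c']
  obtain ⟨κ, ν⟩ := a'
  obtain ⟨κ', μ⟩ := b'
  obtain ⟨μ', ν'⟩ := c'
  simp only [A₀, B₀, C₀, matMulTensor]
  fin_cases κ <;> fin_cases ν <;> fin_cases κ' <;> fin_cases μ <;> fin_cases μ' <;> fin_cases ν' <;>
    simp [aT, bT, cT] <;> ring_nf <;> simp only [hr, hr3] <;> ring_nf

/-- The real case: `⟨2,2,2⟩ ≤ N_{2,3} ⊠ N_{2,3}` over `ℝ` (`r = √5`). [cite: Blaser2013, §5 (the tensor ⟨k,m,n⟩)] -/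
theorem shadowTensor_sq_restrictsTo_matMulTensor_222_real :
    TensorRestrictsTo
      (kroneckerTensor (shadowTensor ℝ 2 3) (shadowTensor ℝ 2 3)) (matMulTensor ℝ 2 2 2) :=
  shadowTensor_sq_restrictsTo_matMulTensor_222 (Real.sqrt 5) (Real.sq_sqrt (by norm_num))

/-- The complex case (the summit's field): `⟨2,2,2⟩ ≤ N_{2,3} ⊠ N_{2,3}` over `ℂ`. [cite: Blaser2013, §5 (the tensor ⟨k,m,n⟩)] -/
theorem shadowTensor_sq_restrictsTo_matMulTensor_222_complex :
    TensorRestrictsTo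
      (kroneckerTensor (shadowTensor ℂ 2 3) (shadowTensor ℂ 2 3)) (matMulTensor ℂ 2 2 2) :=
  shadowTensor_sq_restrictsTo_matMulTensor_222 ((Real.sqrt 5 : ℝ) : ℂ)
    (by rw [← Complex.ofReal_pow, Real.sq_sqrt (by norm_num)]; norm_num)

end Summit.MatrixMultiplication.MatrixMultiplication.Theorems.SaturationLadderShadowLift
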